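import Summits.KontsevichZagierPeriods.KontsevichZagierPeriods.Theorems.SoloInformedDensityCoV
import HarnessLib
import HarnessLib.Audit

/-!
# SoloInformed — positive parts and stacking of regions under graphs (COROLLARY NF.2, file D1 = tree file `SoloInformedStacking`)

Solo programme `solo-KontsevichZagierPeriods-informed`, session s247 (K-NF.2, file D1).

Tools for the density removal of the integrand-additivity moves (rule (1b) of the KZ calculus),
all inside `𝒮 = soloInformedScissorsRel` (generated by scissors moves and volume-preserving maps
between volume representations):

* `soloInformed_of_sub_of_mem_scissorsRel_of_subset`: two volume representations whose domains are
  nested and differ by a null set are congruent modulo `𝒮`;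
* the **positive part** `r⁺ = [σ, max(f, 0)]` of `r = [σ, f]` (`soloInformedPosPart`) and
  `[U(r)] − [U(r⁺)] ∈ 𝒮` (the two regions under the graph differ by a subset of `{t = 0}`), whence
  `sub[r] ≡ [U(r⁺)] − [U((−r)⁺)]` (`soloInformed_sub_of_sub_posPart_mem`);
* the **stacking lemma** (`soloInformed_under_stack_mem_scissorsRel`): for representations
  `a = [V, p + q]`, `b = [V, p]`, `c = [V, q]` with `p, q ≥ 0` on `V` and `p` differentiable at the
  points of `V`,  `[U(a)] − [U(b)] − [U(c)] ∈ 𝒮`:  `U(p + q) = U(p) ∪ Ψ(U(q))` for the shear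
  `Ψ(x, t) = (x, t + p x)` (`ℚ`-semialgebraic, injective, `det DΨ = 1`), the overlap being the graph
  of `p` (null).

References: M. Kontsevich, D. Zagier, *Periods* (2001), §1.2; J. Cresson, J. Viu-Sos, JTNB 34 (2022),
§§3–5; this work, `paper/nl-elimination.md` COROLLARY NF.2.
-/

noncomputable section

open scoped BigOperators Topology ContDiff

namespace Summit.KontsevichZagierPeriods.KontsevichZagierPeriods.Theorems

open Set MeasureTheory Function
open Literature.ModelTheory.ExponentialFields
open Literature.NumberTheory.Transcendental Literature.NumberTheory.Transcendental.KZ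

variable {n : ℕ}

/-! ### Null pieces and nested volume representations -/

/-- If the integrand of `s` is `≤ 0` off a null set `N` then the region under its graph is null (it
lies in the null cylinder over `N` united with the hyperplane `{t = 0}`). [folklore] -/
theorem soloInformed_volume_under_domain_eq_zero_of_nonpos (s : IntegralRep n) {N : Set (Fin n → ℝ)}
    (hN : volume N = 0) (h0 : ∀ x ∈ s.domain, x ∉ N → s.integrand x ≤ 0) :
    volume (soloInformedUnder s).domain = 0 := by
  refine measure_mono_null (t := {z : Fin (n + 1) → ℝ | Fin.init z ∈ N} ∪
      {z : Fin (n + 1) → ℝ | z (Fin.last n) = 0}) (fun z hz => ?_)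
    (measure_union_null (volume_setOf_init_mem_eq_zero hN) soloInformed_volume_setOf_last_eq_zero)
  obtain ⟨h1, h2, h3⟩ := (soloInformed_mem_under_domain s z).mp hz
  by_cases hxN : Fin.init z ∈ N
  · exact Or.inl hxN
  · exact Or.inr (le_antisymm (h3.trans (h0 _ h1 hxN)) h2)

/-- `[U(s)] ∈ 𝒮` when the integrand of `s` is `≤ 0` on its domain. [folklore] -/
theorem soloInformed_of_under_mem_scissorsRel_of_nonpos (s : IntegralRep n)
    (h0 : ∀ x ∈ s.domain, s.integrand x ≤ 0) :
    of (soloInformedUnder s) ∈ soloInformedScissorsRel :=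
  soloInformed_of_mem_scissorsRel_of_volume_eq_zero (soloInformed_isVolRep_under s)
    (soloInformed_volume_under_domain_eq_zero_of_nonpos s (N := ∅) measure_empty
      fun x hx _ => h0 x hx)

/-- **Nested volume representations differing by a null set are congruent**: if `B ⊆ A` are the
domains of volume representations with `A ∖ B` null then `[A] − [B] ∈ 𝒮` (scissors
`[A] = [B] + [A ∖ B]`, and `[A ∖ B]` is null). [folklore] -/
theorem soloInformed_of_sub_of_mem_scissorsRel_of_subset {m : ℕ} {A B : IntegralRep m}
    (hA : SoloInformedIsVolRep A) (hB : SoloInformedIsVolRep B) (hsub : B.domain ⊆ A.domain)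
    (hnull : volume (A.domain \ B.domain) = 0) :
    of A - of B ∈ soloInformedScissorsRel := by
  set C := A.restrict (A.domain \ B.domain) (A.isSemialgebraic_domain.diff B.isSemialgebraic_domain)
    Set.sdiff_subset with hC_def
  have hC : SoloInformedIsVolRep C := fun x hx => hA x hx.1
  have h1 : of A - of B - of C ∈ soloInformedScissorsGen :=
    soloInformed_mem_scissorsGen hA hB hC (Set.union_sdiff_cancel hsub).symm
      (by rw [show B.domain ∩ C.domain = ∅ from Set.inter_sdiff_self _ _, measure_empty])
  have h2 : of C ∈ soloInformedScissorsRel :=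
    soloInformed_of_mem_scissorsRel_of_volume_eq_zero hC hnull
  have : of A - of B
      = (of A - of B - of C) + of C := by abel
  rw [this]
  exact add_mem (soloInformed_scissorsGen_subset_scissorsRel h1) h2

/-! ### Positive parts -/

/-- The positive part `max(f, 0)` of a `ℚ`-semialgebraic function is `ℚ`-semialgebraic
(`max(f, 0) = (f + |f|)/2`). [Bochnak–Coste–Roy 1998, Prop. 2.2.6] -/
theorem soloInformed_isSemialgebraicFunOn_posPart {s : Set (Fin n → ℝ)} {f : (Fin n → ℝ) → ℝ}
    (hs : IsSemialgebraic ℚ s) (hf : IsSemialgebraicFunOn ℚ s f) :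
    IsSemialgebraicFunOn ℚ s (fun x => max (f x) 0) := by
  have h := IsSemialgebraicFunOn.mul_holds (isSemialgebraicFunOn_ratCast hs (1 / 2 : ℚ))
    (IsSemialgebraicFunOn.add_holds hf hf.abs)
  refine h.congr fun x _ => ?_
  show ((1 / 2 : ℚ) : ℝ) * (f x + |f x|) = max (f x) 0
  rcases le_total 0 (f x) with h0 | h0
  · rw [abs_of_nonneg h0, max_eq_left h0]; push_cast; ring
  · rw [abs_of_nonpos h0, max_eq_right h0]; push_cast; ring

/-- **The positive part** `r⁺ = [σ, max(f, 0)]` of `r = [σ, f]`. [folklore] -/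
def soloInformedPosPart (r : IntegralRep n) : IntegralRep n where
  domain := r.domain
  integrand := fun x => max (r.integrand x) 0
  isSemialgebraic_domain := r.isSemialgebraic_domain
  isSemialgebraicFunOn_integrand :=
    soloInformed_isSemialgebraicFunOn_posPart r.isSemialgebraic_domain r.isSemialgebraicFunOn_integrand
  integrableOn := r.integrableOn.pos_part

/-- The domain of `r⁺`. -/
@[simp] theorem soloInformed_posPart_domain (r : IntegralRep n) :
    (soloInformedPosPart r).domain = r.domain :=
  rfl

/-- The integrand of `r⁺`. -/
@[simp] theorem soloInformed_posPart_integrand (r : IntegralRep n) (x : Fin n → ℝ) :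
    (soloInformedPosPart r).integrand x = max (r.integrand x) 0 :=
  rfl

/-- The integrand of `r⁺` is non-negative. -/
theorem soloInformed_posPart_integrand_nonneg (r : IntegralRep n) (x : Fin n → ℝ) :
    0 ≤ (soloInformedPosPart r).integrand x :=
  le_max_right _ _

/-- The integrand of `(−r)⁺` is `max(−f, 0)`. -/
@[simp] theorem soloInformed_posPart_neg_integrand (r : IntegralRep n) (x : Fin n → ℝ) :
    (soloInformedPosPart r.neg).integrand x = max (-r.integrand x) 0 :=
  rfl

/-- `f = max(f,0) − max(−f,0)`: the integrand of `r` is the difference of those of `r⁺` and `(−r)⁺`. -/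
theorem soloInformed_posPart_integrand_sub (r : IntegralRep n) (x : Fin n → ℝ) :
    (soloInformedPosPart r).integrand x - (soloInformedPosPart r.neg).integrand x = r.integrand x :=
  max_zero_sub_max_neg_zero_eq_self _

/-- `U(r) ⊆ U(r⁺)`. -/
theorem soloInformed_under_domain_subset_posPart (r : IntegralRep n) :
    (soloInformedUnder r).domain ⊆ (soloInformedUnder (soloInformedPosPart r)).domain := fun z hz => by
  obtain ⟨h1, h2, h3⟩ := (soloInformed_mem_under_domain r z).mp hz
  exact (soloInformed_mem_under_domain _ z).mpr ⟨h1, h2, h3.trans (le_max_left _ _)⟩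

/-- `U(r⁺) ∖ U(r) ⊆ {t = 0}` is null. [folklore] -/
theorem soloInformed_volume_under_posPart_diff (r : IntegralRep n) :
    volume ((soloInformedUnder (soloInformedPosPart r)).domain \ (soloInformedUnder r).domain) = 0 := by
  refine measure_mono_null (fun z hz => ?_) (soloInformed_volume_setOf_last_eq_zero (n := n))
  obtain ⟨hz1, hz2⟩ := hz
  obtain ⟨h1, h2, h3⟩ := (soloInformed_mem_under_domain _ z).mp hz1
  rw [soloInformed_posPart_integrand] at h3
  rcases le_total (r.integrand (Fin.init z)) 0 with h0 | h0
  · rw [max_eq_right h0] at h3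
    exact le_antisymm h3 h2
  · exact absurd ((soloInformed_mem_under_domain r z).mpr ⟨h1, h2, h3.trans_eq (max_eq_left h0)⟩) hz2

/-- **`[U(r)] − [U(r⁺)] ∈ 𝒮`.** [folklore] -/
theorem soloInformed_under_sub_under_posPart_mem (r : IntegralRep n) :
    of (soloInformedUnder r) - of (soloInformedUnder (soloInformedPosPart r)) ∈
      soloInformedScissorsRel := by
  rw [← neg_sub]
  exact neg_mem (soloInformed_of_sub_of_mem_scissorsRel_of_subset (soloInformed_isVolRep_under _)
    (soloInformed_isVolRep_under r) (soloInformed_under_domain_subset_posPart r)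
    (soloInformed_volume_under_posPart_diff r))

/-- **`sub[r] ≡ [U(r⁺)] − [U((−r)⁺)] (mod 𝒮)`.** [folklore] -/
theorem soloInformed_sub_of_sub_posPart_mem (r : IntegralRep n) :
    soloInformedSub (of r) - (of (soloInformedUnder (soloInformedPosPart r)) -
      of (soloInformedUnder (soloInformedPosPart r.neg))) ∈ soloInformedScissorsRel := by
  rw [soloInformed_sub_of]
  have : of (soloInformedUnder r) - of (soloInformedUnder r.neg) -
      (of (soloInformedUnder (soloInformedPosPart r)) -
        of (soloInformedUnder (soloInformedPosPart r.neg)))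
      = (of (soloInformedUnder r) - of (soloInformedUnder (soloInformedPosPart r))) -
        (of (soloInformedUnder r.neg) -
          of (soloInformedUnder (soloInformedPosPart r.neg))) := by abel
  rw [this]
  exact sub_mem (soloInformed_under_sub_under_posPart_mem r) (soloInformed_under_sub_under_posPart_mem r.neg)

/-! ### The shear `Ψ(x, t) = (x, t + p x)` -/

/-- The derivative of the shear's last component `(x, t) ↦ t + p x`: `(ξ, τ) ↦ τ + p'(ξ)`. -/
def soloInformedStackShearDeriv (p' : (Fin n → ℝ) →L[ℝ] ℝ) : (Fin (n + 1) → ℝ) →L[ℝ] ℝ :=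
  ContinuousLinearMap.proj (R := ℝ) (φ := fun _ : Fin (n + 1) => ℝ) (Fin.last n) +
    p'.comp (soloInformedInitCLM n)

/-- `∂_t (t + p x) = 1`. -/
theorem soloInformed_stackShearDeriv_single (p' : (Fin n → ℝ) →L[ℝ] ℝ) :
    soloInformedStackShearDeriv p' (Pi.single (Fin.last n) 1) = 1 := by
  have h0 : Fin.init (Pi.single (Fin.last n) (1 : ℝ) : Fin (n + 1) → ℝ) = 0 := by
    funext i
    simp [Fin.init, (Fin.castSucc_lt_last i).ne]
  simp [soloInformedStackShearDeriv, soloInformed_initCLM_apply, h0]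

/-- The last component of the shear is differentiable where `p` is. -/
theorem soloInformed_hasFDerivAt_stackShear {p : (Fin n → ℝ) → ℝ} {p' : (Fin n → ℝ) →L[ℝ] ℝ}
    {z : Fin (n + 1) → ℝ} (hp : HasFDerivAt p p' (Fin.init z)) :
    HasFDerivAt (fun y : Fin (n + 1) → ℝ => y (Fin.last n) + p (Fin.init y))
      (soloInformedStackShearDeriv p') z := by
  have h1 := (ContinuousLinearMap.proj (R := ℝ) (φ := fun _ : Fin (n + 1) => ℝ) (Fin.last n)).hasFDerivAt
    (x := z)
  have hp' : HasFDerivAt p p' (soloInformedInitCLM n z) := hp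
  have h2 : HasFDerivAt (fun y : Fin (n + 1) → ℝ => p (Fin.init y)) (p'.comp (soloInformedInitCLM n)) z :=
    hp'.comp z (soloInformedInitCLM n).hasFDerivAt
  exact h1.add h2

/-! ### The stacking lemma -/

/-- **Stacking.**  For `a = [V, p + q]`, `b = [V, p]`, `c = [V, q]` (same domain `V`, `p, q ≥ 0` on
`V`, `p` differentiable at the points of `V`):  `[U(a)] − [U(b)] − [U(c)] ∈ 𝒮`.  Indeed
`U(p + q) = U(p) ∪ Ψ(U(q))` for the shear `Ψ(x, t) = (x, t + p x)` — `ℚ`-semialgebraic, injective,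
`det DΨ = 1`, so `[U(c)] − [Ψ(U(c))]` is a volume-preserving-map move — and `U(p) ∩ Ψ(U(q))` is the
graph of `p`, null, so `[U(a)] − [U(b)] − [Ψ(U(c))]` is a scissors move.
[Kontsevich–Zagier 2001, §1.2; this work, COROLLARY NF.2] -/
theorem soloInformed_under_stack_mem_scissorsRel (a b c : IntegralRep n)
    {p' : (Fin n → ℝ) → (Fin n → ℝ) →L[ℝ] ℝ} (hba : b.domain = a.domain) (hca : c.domain = a.domain)
    (hsum : ∀ x ∈ a.domain, a.integrand x = b.integrand x + c.integrand x)
    (hb0 : ∀ x ∈ a.domain, 0 ≤ b.integrand x) (hc0 : ∀ x ∈ a.domain, 0 ≤ c.integrand x)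
    (hbd : ∀ x ∈ a.domain, HasFDerivAt b.integrand (p' x) x) :
    of (soloInformedUnder a) - of (soloInformedUnder b) -
      of (soloInformedUnder c) ∈ soloInformedScissorsRel := by
  have hS : ∀ z, z ∈ (soloInformedUnder c).domain ↔ Fin.init z ∈ a.domain ∧ 0 ≤ z (Fin.last n) ∧
      z (Fin.last n) ≤ c.integrand (Fin.init z) := fun z => by
    rw [soloInformed_mem_under_domain, hca]
  -- the shear `Ψ(x,t) = (x, t + p x)` on `U(c)`
  set Gs : (Fin (n + 1) → ℝ) → ℝ := fun z => z (Fin.last n) + b.integrand (Fin.init z) with hGs_def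
  set φ : (Fin (n + 1) → ℝ) → (Fin (n + 1) → ℝ) →L[ℝ] ℝ :=
    fun z => soloInformedStackShearDeriv (p' (Fin.init z)) with hφ_def
  have hG : IsSemialgebraicFunOn ℚ (soloInformedUnder c).domain Gs := by
    have h1 : IsSemialgebraicFunOn ℚ (soloInformedUnder c).domain (fun z => z (Fin.last n)) :=
      isSemialgebraicFunOn_apply (soloInformedUnder c).isSemialgebraic_domain (Fin.last n)
    have h2 : IsSemialgebraicFunOn ℚ (soloInformedUnder c).domain
        (fun z => b.integrand (Fin.init z)) :=
      b.isSemialgebraicFunOn_integrand.comp_init.mono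
        (fun z hz => show Fin.init z ∈ b.domain by rw [hba]; exact ((hS z).mp hz).1)
        (soloInformedUnder c).isSemialgebraic_domain
    exact IsSemialgebraicFunOn.add_holds h1 h2
  have hd : ∀ z ∈ (soloInformedUnder c).domain,
      HasFDerivWithinAt Gs (φ z) (soloInformedUnder c).domain z := fun z hz =>
    (soloInformed_hasFDerivAt_stackShear (hbd _ ((hS z).mp hz).1)).hasFDerivWithinAt
  have hinj : InjOn (soloInformedLastSubst Gs) (soloInformedUnder c).domain :=
    soloInformed_injOn_lastSubst_of_strictMono fun z _ z' _ hi hlt => by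
      show z (Fin.last n) + b.integrand (Fin.init z) < z' (Fin.last n) + b.integrand (Fin.init z')
      rw [hi]
      linarith
  have hjac : ∀ z ∈ (soloInformedUnder c).domain,
      (soloInformedUnder c).integrand z = |φ z (Pi.single (Fin.last n) 1)| := fun z _ => by
    rw [soloInformed_under_integrand, hφ_def, soloInformed_stackShearDeriv_single, abs_one]
  -- the image representation `M = [Ψ(U(c)), 1]`
  set M := soloInformedLastSubstRep (soloInformedUnder c) Gs φ hG hd hinj hjac with hM_def
  have hMvol : SoloInformedIsVolRep M := fun w _ =>
    soloInformed_lastSubstRep_integrand _ _ _ hG hd hinj hjac w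
  have hMdom : M.domain = {w : Fin (n + 1) → ℝ | Fin.init w ∈ a.domain ∧
      b.integrand (Fin.init w) ≤ w (Fin.last n) ∧
      w (Fin.last n) ≤ b.integrand (Fin.init w) + c.integrand (Fin.init w)} := by
    rw [hM_def, soloInformed_lastSubstRep_domain]
    ext w
    constructor
    · rintro ⟨z, hz, rfl⟩
      obtain ⟨hx, h0, hq⟩ := (hS z).mp hz
      refine ⟨?_, ?_, ?_⟩
      · rw [soloInformed_init_lastSubst]; exact hx
      · rw [soloInformed_init_lastSubst, soloInformed_lastSubst_apply_last]
        show b.integrand (Fin.init z) ≤ z (Fin.last n) + b.integrand (Fin.init z)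
        linarith
      · rw [soloInformed_init_lastSubst, soloInformed_lastSubst_apply_last]
        show z (Fin.last n) + b.integrand (Fin.init z) ≤ _
        linarith
    · rintro ⟨hx, h1, h2⟩
      refine ⟨Fin.snoc (Fin.init w) (w (Fin.last n) - b.integrand (Fin.init w)), (hS _).mpr ?_, ?_⟩
      · simp only [Fin.init_snoc, Fin.snoc_last]
        exact ⟨hx, by linarith, by linarith⟩
      · rw [soloInformed_lastSubst_eq_snoc]
        simp only [hGs_def, Fin.init_snoc, Fin.snoc_last, sub_add_cancel, Fin.snoc_init_self]
  -- the map move `[U(c)] − [M]`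
  have hmap : of (soloInformedUnder c) - of M ∈ soloInformedMapGen :=
    ⟨n + 1, n + 1, soloInformedUnder c, M, rfl, soloInformed_isVolRep_under c, hMvol,
      soloInformed_of_sub_of_lastSubstRep_mem_changeOfVariablesRel _ _ _ hG hd hinj hjac, rfl⟩
  -- the scissors move `[U(a)] − [U(b)] − [M]`
  have hsc : of (soloInformedUnder a) - of (soloInformedUnder b) - of M ∈
      soloInformedScissorsGen := by
    refine soloInformed_mem_scissorsGen (soloInformed_isVolRep_under a) (soloInformed_isVolRep_under b)
      hMvol ?_ ?_
    · rw [hMdom]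
      ext z
      rw [soloInformed_mem_under_domain, mem_union, soloInformed_mem_under_domain, hba, mem_setOf_eq]
      constructor
      · rintro ⟨hx, h0, ha⟩
        rw [hsum _ hx] at ha
        rcases le_total (z (Fin.last n)) (b.integrand (Fin.init z)) with h | h
        · exact Or.inl ⟨hx, h0, h⟩
        · exact Or.inr ⟨hx, h, ha⟩
      · rintro (⟨hx, h0, hb⟩ | ⟨hx, h1, h2⟩)
        · refine ⟨hx, h0, ?_⟩
          rw [hsum _ hx]
          linarith [hc0 _ hx]
        · refine ⟨hx, ?_, ?_⟩
          · linarith [hb0 _ hx]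
          · rw [hsum _ hx]; exact h2
    · rw [hMdom]
      refine measure_mono_null (fun z hz => ?_)
        (volume_graph_eq_zero (σ := a.domain) (u := b.integrand) (hba ▸ b.isSemialgebraicFunOn_integrand))
      obtain ⟨hz1, hx, h1, -⟩ := hz
      obtain ⟨-, -, hb⟩ := (soloInformed_mem_under_domain b z).mp hz1
      exact ⟨hx, le_antisymm hb h1⟩
  -- combine
  have : of (soloInformedUnder a) - of (soloInformedUnder b) -
      of (soloInformedUnder c)
      = (of (soloInformedUnder a) - of (soloInformedUnder b) - of M) -
        (of (soloInformedUnder c) - of M) := by abel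
  rw [this]
  exact sub_mem (soloInformed_scissorsGen_subset_scissorsRel hsc)
    (soloInformed_mapGen_subset_scissorsRel hmap)

end Summit.KontsevichZagierPeriods.KontsevichZagierPeriods.Theorems

end
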